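import Literature.NumberTheory.Automorphic.ParabolicGLExactProofs
import Literature.NumberTheory.Automorphic.Liu2021.LemD1SplitPlaceOfFacts
import Mathlib.RingTheory.SimpleModule.Rank
import HarnessLib

/-!
# Induction from the whole group of a character: the degenerate cases `N = 0, 1` of `(ν₀ ∘ det) × χ′`

Topic `NumberTheory/Automorphic/Zelevinsky1980`; theorems only (no definition, no named fact).  Let `G` be a
topological group, `H ≤ G` a subgroup with `H = G` (as a subgroup: `∀ g, g ∈ H`) and `σ` a smooth
representation of `H` on `W`.  Then evaluation at `1` identifies the smooth induction `Ind_H^G σ`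
(`Representation.SmoothInd H σ`, functions `f (h g) = σ(h) f(g)` smooth under right translation) with `W`:

* `SmoothInd.toFun_eq_apply_toFun_one_of_forall_mem` — `f(g) = σ(g) f(1)`;
* `SmoothInd.toFun_one_injective_of_forall_mem` — `f ↦ f(1)` is injective;
* `SmoothInd.exists_toFun_eq_apply_of_forall_mem` — for smooth `σ` every `w` is attained: `g ↦ σ(g) w ∈ Ind_H^G σ`;
* `SmoothInd.finrank_eq_of_forall_mem` — hence `dim Ind_H^G σ = dim W`, and
* `isIrreducible_smoothIndRep_of_forall_mem` — `Ind_G^G σ` is IRREDUCIBLE when `dim W = 1`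
  (a representation on a line is irreducible: Mathlib `isSimpleModule_iff_finrank_eq_one`).

Applied to `GL_n(F)` over a non-archimedean local field `F` with a block labelling `c : n → α` on a type `n`
with at most one element (`standardParabolicGL_eq_top_of_subsingleton_index`: `P_c = GL_n`), the normalised
parabolic induction `Representation.parabolicIndGL F c σ` of a smooth character is irreducible
(`parabolicIndGL_isIrreducible_of_subsingleton`); in particular — the degenerate cases `N = 0, 1` of
Zelevinsky's theorem for `(ν₀ ∘ det_{GL_{N-1}}) × χ′` (named fact
`Zelevinsky1980.parabolicIndGL_detChar_unitary_isIrreducible`, whose `∀ N` includes them; Zelevinsky 1980,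
§3.2: «it is convenient to denote by `⟨∅⟩` the identity representation of the group `G₀ = {e}`», and for
`N = 1` the induced representation is the character `χ′` of `G₁ = Fˣ` itself) —
`parabolicIndGL_detChar_isIrreducible_of_le_one`: for `N ≤ 1` and CONTINUOUS `ν₀, χ′` the representation
`parabolicIndGL F (lastBlockLabel N) (𝟙.twist (maxParabolicLeviChar F N ν₀ χ′))` is irreducible (unitarity is
not needed here).  The cases `N ≥ 2` are `Zelevinsky1980/InducedMaximalParabolicEndomorphisms` (cell
hodgecm-mathlib, row IV-3b).

## References

* A. V. Zelevinsky, *Induced representations of reductive `p`-adic groups II*, Ann. Sci. ÉNS 13 (1980),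
  §1.1, §3.2 (p. 181), Thm. 4.2. [Zelevinsky1980]
* I. N. Bernstein, A. V. Zelevinsky, *Representations of the group GL(n, F) where F is a non-archimedean
  local field*, Russian Math. Surveys 31:3 (1976), §2.21–2.24 (induction). [BernsteinZelevinskyRMS1976]
-/

noncomputable section

namespace Literature.NumberTheory.Automorphic

/-! ### Smooth induction from the whole group -/

section Top

variable {k G W : Type*} [CommRing k] [Group G] [TopologicalSpace G] [IsTopologicalGroup G]
  [AddCommGroup W] [Module k W] {H : Subgroup G} (σ : Representation k H W)

/-- **`f(g) = σ(g) f(1)`** for `f ∈ Ind_H^G σ` when `H = G`. [cite: BernsteinZelevinskyRMS1976, §2.21] -/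
theorem SmoothInd.toFun_eq_apply_toFun_one_of_forall_mem (hH : ∀ g : G, g ∈ H)
    (f : Representation.SmoothInd H σ) (g : G) : f.toFun g = σ ⟨g, hH g⟩ (f.toFun 1) := by
  have := f.toFun_subgroup_mul ⟨g, hH g⟩ 1
  rwa [Subgroup.coe_mk, mul_one] at this

/-- **Evaluation at `1` is injective on `Ind_G^G σ`.** [cite: BernsteinZelevinskyRMS1976, §2.21] -/
theorem SmoothInd.toFun_one_injective_of_forall_mem (hH : ∀ g : G, g ∈ H) :
    Function.Injective fun f : Representation.SmoothInd H σ => f.toFun 1 := by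
  intro f₁ f₂ h
  refine Representation.SmoothInd.ext (funext fun g => ?_)
  rw [SmoothInd.toFun_eq_apply_toFun_one_of_forall_mem σ hH f₁,
    SmoothInd.toFun_eq_apply_toFun_one_of_forall_mem σ hH f₂]
  exact congrArg _ h

/-- **The orbit maps `g ↦ σ(g) w` exhaust `Ind_G^G σ` for smooth `σ`**: for every `w ∈ W` there is
`f ∈ Ind_H^G σ` (`H = G`) with `f(g) = σ(g) w`; it is a smooth vector because its stabiliser under right
translation contains the (open) stabiliser of `w`. [cite: BernsteinZelevinskyRMS1976, §2.21] -/
theorem SmoothInd.exists_toFun_eq_apply_of_forall_mem (hH : ∀ g : G, g ∈ H) (hσ : σ.IsSmooth) (w : W) :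
    ∃ f : Representation.SmoothInd H σ, ∀ g : G, f.toFun g = σ ⟨g, hH g⟩ w := by
  -- the function and its `H`-equivariance
  have hmem : (fun g : G => σ ⟨g, hH g⟩ w) ∈ Representation.coindV H.subtype σ := by
    refine (Representation.mem_indFun_iff H σ _).2 fun h g => ?_
    have : (⟨(h : G) * g, hH _⟩ : H) = h * ⟨g, hH g⟩ := Subtype.ext rfl
    simp only [this, map_mul, Module.End.mul_apply]
  -- `H` is open in `G` (it is everything), so the stabiliser of `w` is open in `G`
  have hHo : IsOpen (H : Set G) := by
    rw [Set.eq_univ_iff_forall.2 (fun g => (hH g : g ∈ (H : Set G)))]; exact isOpen_univ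
  have hSo : IsOpen (((σ.stabilizerSubgroup w).map H.subtype : Subgroup G) : Set G) := by
    rw [Subgroup.coe_map, Subgroup.coe_subtype]
    exact hHo.isOpenMap_subtype_val _ (hσ w)
  refine ⟨⟨⟨fun g : G => σ ⟨g, hH g⟩ w, hmem⟩, ?_⟩, fun g => rfl⟩
  show (Representation.indFun H σ).IsSmoothVector _
  refine Subgroup.isOpen_mono (H₁ := (σ.stabilizerSubgroup w).map H.subtype) (fun g hg => ?_) hSo
  obtain ⟨h, hh, rfl⟩ := Subgroup.mem_map.1 hg
  rw [Representation.mem_stabilizerSubgroup] at hh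
  rw [Representation.mem_stabilizerSubgroup]
  refine Subtype.ext (funext fun x => ?_)
  rw [Representation.indFun_apply_apply]
  change σ ⟨x * (h : G), hH _⟩ w = σ ⟨x, hH x⟩ w
  have : (⟨x * (h : G), hH _⟩ : H) = ⟨x, hH x⟩ * h := Subtype.ext rfl
  rw [this, map_mul, Module.End.mul_apply, hh]

/-- **`Ind_G^G σ ≃ W` by evaluation at `1`** (for smooth `σ`, `H = G`): there is a `k`-linear equivalence
`e` with `e f = f(1)`. [cite: BernsteinZelevinskyRMS1976, §2.21] -/
theorem SmoothInd.exists_linearEquiv_of_forall_mem (hH : ∀ g : G, g ∈ H) (hσ : σ.IsSmooth) :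
    ∃ e : Representation.SmoothInd H σ ≃ₗ[k] W, ∀ f, e f = f.toFun 1 := by
  let ev : Representation.SmoothInd H σ →ₗ[k] W :=
    { toFun := fun f => f.toFun 1
      map_add' := fun f₁ f₂ => by rw [Representation.SmoothInd.toFun_add, Pi.add_apply]
      map_smul' := fun c f => by rw [Representation.SmoothInd.toFun_smul, Pi.smul_apply, RingHom.id_apply] }
  have hbij : Function.Bijective ev := by
    refine ⟨SmoothInd.toFun_one_injective_of_forall_mem σ hH, fun w => ?_⟩
    obtain ⟨f, hf⟩ := SmoothInd.exists_toFun_eq_apply_of_forall_mem σ hH hσ w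
    refine ⟨f, ?_⟩
    change f.toFun 1 = w
    rw [hf 1]
    have : (⟨(1 : G), hH 1⟩ : H) = 1 := Subtype.ext rfl
    rw [this, map_one, Module.End.one_apply]
  exact ⟨LinearEquiv.ofBijective ev hbij, fun f => rfl⟩

/-- **`dim Ind_G^G σ = dim W`** (for smooth `σ`, `H = G`). [cite: BernsteinZelevinskyRMS1976, §2.21] -/
theorem SmoothInd.finrank_eq_of_forall_mem (hH : ∀ g : G, g ∈ H) (hσ : σ.IsSmooth) :
    Module.finrank k (Representation.SmoothInd H σ) = Module.finrank k W := by
  obtain ⟨e, -⟩ := SmoothInd.exists_linearEquiv_of_forall_mem σ hH hσ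
  exact e.finrank_eq

end Top

section TopField

variable {k G W : Type*} [Field k] [Group G] [TopologicalSpace G] [IsTopologicalGroup G]
  [AddCommGroup W] [Module k W] {H : Subgroup G} (σ : Representation k H W)

/-- **Induction from the whole group of a smooth character is irreducible**: if `H = G`, `σ` is smooth and
`dim W = 1`, then `Ind_H^G σ` (`Representation.smoothIndRep`) is irreducible — it is one-dimensional.
[cite: BernsteinZelevinskyRMS1976, §2.21] -/
theorem isIrreducible_smoothIndRep_of_forall_mem (hH : ∀ g : G, g ∈ H) (hσ : σ.IsSmooth)
    (hW : Module.finrank k W = 1) : (Representation.smoothIndRep H σ).IsIrreducible := by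
  -- a representation on a line is irreducible (cf. the tree's
  -- `Literature.Barriers.QuantumFields.isIrreducible_of_finrank_eq_one`, not imported from its lattice-gauge file)
  have h1 : Module.finrank k (Representation.SmoothInd H σ) = 1 :=
    (SmoothInd.finrank_eq_of_forall_mem σ hH hσ).trans hW
  haveI : IsSimpleModule k (Representation.SmoothInd H σ) := isSimpleModule_iff_finrank_eq_one.2 h1
  haveI : Nontrivial (Subrepresentation (Representation.smoothIndRep H σ)) := ⟨⟨⊥, ⊤, fun hbt =>
    bot_ne_top (α := Submodule k (Representation.SmoothInd H σ)) (congrArg Subrepresentation.toSubmodule hbt)⟩⟩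
  refine ⟨fun U => ?_⟩
  rcases eq_bot_or_eq_top U.toSubmodule with hU | hU
  · exact Or.inl (Subrepresentation.toSubmodule_injective hU)
  · exact Or.inr (Subrepresentation.toSubmodule_injective hU)

end TopField

/-! ### `GL_n` with at most one index: `P_c = GL_n` and `i_c σ` is a character -/

section GLn

/-- With at most one INDEX every invertible matrix is block triangular for any labelling: `P_c = GL_n(R)`
(companion of `standardParabolicGL_eq_top_of_subsingleton`, which assumes one LABEL); in print, the
standard parabolic of the one-block partition `(n)` is `G_n` itself [Zelevinsky1980, §1.1, p. 170].
[cite: Zelevinsky1980, §1.1, p. 170] -/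
theorem standardParabolicGL_eq_top_of_subsingleton_index (R : Type*) [CommRing R] {n : Type*} [Fintype n]
    [DecidableEq n] [Subsingleton n] {α : Type*} [LinearOrder α] (c : n → α) :
    standardParabolicGL R c = ⊤ :=
  (Subgroup.eq_top_iff' _).2 fun g => (mem_standardParabolicGL_iff c g).2
    fun i j hij => absurd (congrArg c (Subsingleton.elim j i)) hij.ne

variable (F : Type*) [Field F] [ValuativeRel F] [TopologicalSpace F] [IsNonarchimedeanLocalField F]
  {n : Type*} [Fintype n] [DecidableEq n] {α : Type*} [LinearOrder α] (c : n → α)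

/-- **`i_c σ` is irreducible for a smooth character `σ` when `GL_n` has at most one index** (`n` a
subsingleton, so `P_c = GL_n` and `i_c σ = σ ∘ proj ⊗ δ^{1/2}` is a smooth character of `GL_n` itself).
[cite: Zelevinsky1980, §3.2, p. 181] -/
theorem parabolicIndGL_isIrreducible_of_subsingleton [Subsingleton n] [LocallyCompactSpace (standardParabolicGL F c)]
    {W : Type*} [AddCommGroup W] [Module ℂ W] (σ : Representation ℂ (Π a, GL {i // c i = a} F) W)
    (hσ : σ.IsSmooth) (hW : Module.finrank ℂ W = 1) :
    (Representation.parabolicIndGL F c σ).IsIrreducible :=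
  isIrreducible_smoothIndRep_of_forall_mem _
    ((Subgroup.eq_top_iff' _).1 (standardParabolicGL_eq_top_of_subsingleton_index F c))
    (Representation.IsSmooth.twist_comp_leviProjection F c hσ) hW

end GLn

end Literature.NumberTheory.Automorphic

/-! ### The degenerate cases `N = 0, 1` of `(ν₀ ∘ det_{GL_{N-1}}) × χ′` -/

namespace Literature.NumberTheory.Automorphic.Zelevinsky1980

open Literature.NumberTheory.Automorphic

/-- **Zelevinsky's `(ν₀ ∘ det) × χ′` for `N ≤ 1` is irreducible.** For a non-archimedean local field `F`,
`N ≤ 1` and continuous characters `ν₀, χ′ : Fˣ → ℂˣ`, the normalised parabolic induction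
`parabolicIndGL F (lastBlockLabel N) (𝟙.twist (maxParabolicLeviChar F N ν₀ χ′))` is irreducible: `Fin N` has at
most one element, so `Q_{N-1,1} = GL_N` and the induced representation is the (smooth, by
`Liu2021.SplitPlace.isAdmissible_trivial_twist` / `isOpen_ker_maxParabolicLeviChar` / `isOpen_ker_of_continuous`)
one-dimensional inducing character itself (`⟨∅⟩`, resp. `χ′` on `G₁ = Fˣ`).  These are the cases `N = 0, 1` of the
named fact `parabolicIndGL_detChar_unitary_isIrreducible` (same binders; unitarity unused).
[cite: Zelevinsky1980, §3.2, p. 181 and Thm. 4.2] -/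
theorem parabolicIndGL_detChar_isIrreducible_of_le_one (F : Type*) [Field F] [ValuativeRel F] [TopologicalSpace F]
    [IsNonarchimedeanLocalField F] (N : ℕ) (hN : N ≤ 1)
    [LocallyCompactSpace (standardParabolicGL F (lastBlockLabel N))]
    (ν₀ χ' : Fˣ →* ℂˣ) (hν₀c : Continuous fun x => ((ν₀ x : ℂˣ) : ℂ))
    (hχ'c : Continuous fun x => ((χ' x : ℂˣ) : ℂ)) :
    (Representation.parabolicIndGL F (lastBlockLabel N)
      ((Representation.trivial ℂ (Π a : Bool, GL {i : Fin N // lastBlockLabel N i = a} F) ℂ).twist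
        (maxParabolicLeviChar F N ν₀ χ'))).IsIrreducible := by
  haveI : Subsingleton (Fin N) := Fin.subsingleton_iff_le_one.2 hN
  exact parabolicIndGL_isIrreducible_of_subsingleton F (lastBlockLabel N) _
    (Liu2021.SplitPlace.isAdmissible_trivial_twist _
      (Liu2021.SplitPlace.isOpen_ker_maxParabolicLeviChar N ν₀ χ'
        (Liu2021.SplitPlace.isOpen_ker_of_continuous ν₀ hν₀c)
        (Liu2021.SplitPlace.isOpen_ker_of_continuous χ' hχ'c))).isSmooth
    (Module.finrank_self ℂ)

end Literature.NumberTheory.Automorphic.Zelevinsky1980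

end
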